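import Mathlib.CategoryTheory.Limits.Constructions.FiniteProductsOfBinaryProducts
import Mathlib.CategoryTheory.Limits.Shapes.Biproducts
import Mathlib.CategoryTheory.Preadditive.Biproducts
import Literature.AlgebraicGeometry.Motives.AbelianVariety
import Literature.AlgebraicGeometry.Motives.AbelianVarietyProduct

/-!
# Crux `HodgeAbelianVarieties` (stmt-HodgeConjecture-1333), line `cm-pivot-andre` — finite biproducts of abelian varieties

Helper W1 toward the registered stub `stub_andreSplitWeilCM` (André 1992: every Hodge class on a
CM abelian variety is a sum of pull-backs of Weil classes from CM abelian varieties of Weil type).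
André's construction uses the abelian variety `A ⊗ 𝒪_E := Aⁿ`, `n = [E : ℚ]`, with its
integer-matrix action, i.e. the finite biproduct `⨁ (fun _ : Fin n ↦ A)` in the preadditive category
`AbelianVariety ℂ`. The tree (`Motives/AbelianVarietyProduct`) has binary products and binary
biproducts of abelian varieties but no terminal object; this file supplies it and deduces finite
(bi)products. Everything is a theorem (Prop-valued; use `attribute [local instance]` or `haveI`
downstream):

* `geometricallyIntegral_id_Spec`: the identity of `Spec k` is geometrically integral (its base
  change to any field-valued point is an isomorphism onto the spectrum of a field);
* `hasTerminal_abelianVariety`: the zero abelian variety `Spec k → Spec k` with the trivial group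
  law — the monoidal unit `𝟙_ (Over (Spec k))` with Mathlib's `GrpObj.instTensorUnit`, whose
  underlying group object is Mathlib's `Grp.trivial (Over (Spec k))` — receives exactly one
  homomorphism from every abelian variety (Mathlib `Grp.uniqueHomToTrivial`, the category of abelian
  varieties being the full subcategory of `Grp (Over (Spec k))` induced along `AbelianVariety.toGrp`),
  so it is terminal (Mathlib `hasTerminal_of_unique`);
* `hasFiniteProducts_abelianVariety`, `hasFiniteBiproducts_abelianVariety_of_field`: Mathlib's
  `hasFiniteProducts_of_has_binary_and_terminal` and `HasFiniteBiproducts.of_hasFiniteProducts`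
  (the category is preadditive, `AbelianVariety.instPreadditive`);
* `hasFiniteBiproducts_abelianVariety`: the registered signature, over `ℂ`.

References: D. Mumford, *Abelian Varieties* (1970), §4 (definition; `Spec k` is an abelian variety
of dimension `0`) and §19 (`Hom(A × B, C) = Hom(A, C) ⊕ Hom(B, C)`); J. S. Milne, *Abelian Varieties*
(1986), §1.
-/

set_option linter.dupNamespace false

noncomputable section

namespace Summit.HodgeConjecture.HodgeConjecture.Theorems.HodgeAbelianVarieties.CMPivotAndre

open CategoryTheory CategoryTheory.Limits AlgebraicGeometry MonoidalCategory
open Literature.AlgebraicGeometry.Motives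

universe u

/-- **The identity of `Spec k` is geometrically integral**: if `Z` with `Z → Spec k`, `Z → Spec K`
is a base change of `𝟙 (Spec k)` along a field-valued point `Spec K → Spec k`, then `Z → Spec K` is
an isomorphism (base change of an isomorphism, Mathlib `IsPullback.isIso_snd_of_isIso`), so `Z` is
integral like `Spec K` (Mathlib `IsIntegral.of_isIso`). [folklore] -/
theorem geometricallyIntegral_id_Spec (k : Type u) [Field k] :
    GeometricallyIntegral (𝟙 (Spec (CommRingCat.of k))) :=
  ⟨fun _ _ _ _ _ snd h ↦ by
    haveI := h.isIso_snd_of_isIso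
    exact IsIntegral.of_isIso (inv snd)⟩

/-- **`AbelianVariety k` has a terminal object, the zero abelian variety** `Spec k → Spec k` with the
trivial group law (Mumford, *Abelian Varieties*, §4: the abelian variety of dimension `0`). Real
proof: the monoidal unit `𝟙_ (Over (Spec k))` (structure morphism `𝟙 (Spec k)`, Mathlib
`Over.tensorUnit_hom`; proper as an identity, geometrically integral by
`geometricallyIntegral_id_Spec`) with Mathlib's trivial group-object structure
`GrpObj.instTensorUnit` is an abelian variety `T` whose underlying group object `T.toGrp` is
Mathlib's `Grp.trivial (Over (Spec k))` (definitionally); morphisms `A ⟶ T` are, by the induced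
category structure (`AbelianVariety.instCategory`, Mathlib `InducedCategory.homEquiv`), morphisms of
group objects `A.toGrp ⟶ Grp.trivial _`, of which there is exactly one (Mathlib
`Grp.uniqueHomToTrivial`); conclude by Mathlib `hasTerminal_of_unique`. [folklore] -/
theorem hasTerminal_abelianVariety (k : Type u) [Field k] : HasTerminal (AbelianVariety k) := by
  let T : AbelianVariety k :=
    { X := 𝟙_ (SchemeOver k)
      grpObj := GrpObj.instTensorUnit
      isProper := inferInstanceAs (IsProper (𝟙 (Spec (CommRingCat.of k))))
      geometricallyIntegral := geometricallyIntegral_id_Spec k }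
  haveI : ∀ A : AbelianVariety k, Unique (A ⟶ T) := fun A ↦
    haveI : Unique (A.toGrp ⟶ T.toGrp) := Grp.uniqueHomToTrivial A.toGrp
    InducedCategory.homEquiv.unique
  exact hasTerminal_of_unique T

/-- **`AbelianVariety k` has finite products**: it has binary products
(`AbelianVariety.hasBinaryProducts_inst`, `Motives/AbelianVarietyProduct`) and a terminal object
(`hasTerminal_abelianVariety`), so Mathlib's `hasFiniteProducts_of_has_binary_and_terminal` applies
(Mumford §19: `A₁ × ⋯ × Aₙ`). [folklore] -/
theorem hasFiniteProducts_abelianVariety (k : Type u) [Field k] :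
    HasFiniteProducts (AbelianVariety k) :=
  haveI := hasTerminal_abelianVariety k
  hasFiniteProducts_of_has_binary_and_terminal

/-- **`AbelianVariety k` has finite biproducts**: it is preadditive (`AbelianVariety.instPreadditive`)
with finite products (`hasFiniteProducts_abelianVariety`), so Mathlib's
`HasFiniteBiproducts.of_hasFiniteProducts` applies. This is the content of
`Hom(C, ∏ Aᵢ) = ⊕ Hom(C, Aᵢ)` and `Hom(∏ Aᵢ, C) = ⊕ Hom(Aᵢ, C)` (Mumford §19). [folklore] -/
theorem hasFiniteBiproducts_abelianVariety_of_field (k : Type u) [Field k] :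
    HasFiniteBiproducts (AbelianVariety k) :=
  haveI := hasFiniteProducts_abelianVariety k
  HasFiniteBiproducts.of_hasFiniteProducts

/-- **Finite biproducts of complex abelian varieties** (helper W1 of line `cm-pivot-andre` toward
`stub_andreSplitWeilCM`): the preadditive category `AbelianVariety ℂ` of complex abelian varieties
with homomorphisms has all finite biproducts `⨁ Aᵢ` — in particular the powers
`Aⁿ = ⨁ (fun _ : Fin n ↦ A)` carrying André's `𝒪_E`-action by integer matrices. The registered
signature, verbatim; it is `hasFiniteBiproducts_abelianVariety_of_field ℂ` (downstream:
`attribute [local instance] hasFiniteBiproducts_abelianVariety`). [folklore] -/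
theorem hasFiniteBiproducts_abelianVariety : CategoryTheory.Limits.HasFiniteBiproducts (Literature.AlgebraicGeometry.Motives.AbelianVariety ℂ) :=
  hasFiniteBiproducts_abelianVariety_of_field ℂ

end Summit.HodgeConjecture.HodgeConjecture.Theorems.HodgeAbelianVarieties.CMPivotAndre

end
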